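import Summits.BirchSwinnertonDyer.BirchSwinnertonDyer.Theorems.SignedBaseChangeAnticyclotomicEisensteinDivisibilitySpecializationS2
import HarnessLib

/-!
# Stub S2 of line `bdpline` from "`X_Gr₂` finitely generated and `Λ₂`-torsion" (instead of a killing
# element with nonzero constant term) — the dichotomy on `(T₁) ∈ Supp X_Gr₂`

Helper file (--supports stmt-BirchSwinnertonDyer-20727), sequel of `…SpecializationS2.lean` (lead prover
sbc-p1 g7). There the conclusion of the old stub S2 (`π(ch(X_Gr₂)·Λ^ur) ⊆ ch(X_ac)·𝒪⟦T⟧`) was derived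
from a killing element `s` with `s(0) ≠ 0`, i.e. from "`X_Gr₂` torsion AND `(T₁) ∉ Supp X_Gr₂`". The
second clause is unnecessary for the INCLUSION: if `(T₁) ∈ Supp X_Gr₂` then `ch_{Λ₂}(X_Gr₂) ⊆ (T₁)`
(`charIdeal_le_of_lengthAt_ne_zero`), so `π(ch X_Gr₂) = 0` and the inclusion is trivial. Hence the
arithmetic input of the line shrinks to the STANDARD one — `X_Gr(E/K̃_∞)` is a finitely generated
torsion `Λ₂`-module (stub `stub_fgTorsionSS` of skeleton v4) — plus `X_Gr₂[T₁] = 0` and control: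

* `LocalLength.charIdeal_le_of_lengthAt_ne_zero` — for a f.g. torsion module over a Noetherian domain,
  `ℓ_𝔭(M) ≠ 0` at a height-one prime `𝔭` gives `char(M) ⊆ 𝔭` (`𝔭^{ℓ_𝔭} ∣ char M`);
* `S2.map_toUnr₂_map_constantCoeff_eq_bot_of_lengthAt_ne_zero` — `(T₁) ∈ Supp X ⟹ π(ch X · Λ^ur) = 0`;
* `S2.map_toUnr₂_map_constantCoeff_le_of_isTorsion`, `S2.xGr₂_specialization_le_of_isTorsion` — the
  conclusion of stub S2 from `[Module.Finite Λ₂ X]`, `Module.IsTorsion Λ₂ X`, `X[T₁] = 0` and a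
  surjective `Λ₁`-linear control map `X/T₁X ↠ Y` (constants structure).

Pure algebra; nothing about elliptic curves is asserted.
-/

-- D-0017: single-problem summit, the namespace repeats the problem name by design.
set_option linter.dupNamespace false
set_option autoImplicit false

noncomputable section

open Function
open scoped Pointwise

namespace Summit.BirchSwinnertonDyer.BirchSwinnertonDyer.Theorems.SignedBaseChangeAcDivSpecialization

open Literature.NumberTheory.EllipticCurves Literature.NumberTheory.EllipticCurves.Module

namespace LocalLength

variable {R : Type*} [CommRing R] {M : Type*} [AddCommGroup M] [Module R M]

/-- For a finitely generated torsion module over a Noetherian domain and a height-one prime `𝔭` in its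
support (`ℓ_𝔭(M) ≠ 0`): `char(M) ⊆ 𝔭`, since `𝔭 ^ ℓ_𝔭(M)` divides the finite product `char(M)`.
[folklore] -/
theorem charIdeal_le_of_lengthAt_ne_zero [IsNoetherianRing R] [IsDomain R] [Module.Finite R M]
    (hM : Module.IsTorsion R M) {𝔭 : PrimeSpectrum R} (h𝔭 : 𝔭.asIdeal.height = 1)
    (h : lengthAt R M 𝔭 ≠ 0) : charIdeal R M ≤ 𝔭.asIdeal := by
  obtain ⟨s, hsann, hs0⟩ := Submodule.annihilator_top_inter_nonZeroDivisors hM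
  have hs : s ≠ 0 := nonZeroDivisors.ne_zero hs0
  have hsM : Module.IsTorsionBy R M s := fun x =>
    Submodule.mem_annihilator.mp hsann x Submodule.mem_top
  have hfin := finite_heightOne_inter_mulSupport hs hsM
  have hn : (lengthAt R M 𝔭).toNat ≠ 0 := by
    rw [Ne, ENat.toNat_eq_zero, not_or]
    exact ⟨h, lengthAt_ne_top_of_isTorsionBy hs hsM 𝔭 (le_of_eq h𝔭)⟩
  have hdvd : 𝔭.asIdeal ^ (lengthAt R M 𝔭).toNat ∣ charIdeal R M := by
    unfold charIdeal
    rw [finprod_mem_def]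
    have hmem : 𝔭 ∈ {𝔭 : PrimeSpectrum R | 𝔭.asIdeal.height = 1} := h𝔭
    have := finprod_mem_dvd 𝔭
      (f := {𝔭 : PrimeSpectrum R | 𝔭.asIdeal.height = 1}.mulIndicator
        fun 𝔭 => 𝔭.asIdeal ^ (lengthAt R M 𝔭).toNat)
      (by rw [Function.HasFiniteMulSupport, Set.mulSupport_mulIndicator]; exact hfin)
    rwa [Set.mulIndicator_of_mem hmem] at this
  exact (Ideal.le_of_dvd hdvd).trans (Ideal.pow_le_self hn)

end LocalLength

namespace S2

open LocalLength PowerSeriesSpecialization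

/-- **`(T₁) ∈ Supp X ⟹ π(ch_{Λ₂} X · Λ^ur) = 0`**: if the local length of the finitely generated torsion
`Λ₂`-module `X` at the height-one prime `(T₁)` is nonzero then `ch_{Λ₂}(X) ⊆ (T₁)`, whose image under
`T₁ ↦ 0` (after any coefficient extension `J`) vanishes. [folklore] -/
theorem map_toUnr₂_map_constantCoeff_eq_bot_of_lengthAt_ne_zero (p : ℕ) [Fact p.Prime] (X : Type*)
    [AddCommGroup X] [Module (PowerSeries (IwasawaAlgebra p)) X]
    [Module.Finite (PowerSeries (IwasawaAlgebra p)) X]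
    (htors : Module.IsTorsion (PowerSeries (IwasawaAlgebra p)) X)
    (h0 : lengthAt (PowerSeries (IwasawaAlgebra p)) X
      ⟨Ideal.span {(PowerSeries.X : PowerSeries (IwasawaAlgebra p))}, PowerSeries.span_X_isPrime⟩ ≠ 0)
    (J : ℤ_[p] →+* PadicComplexInt p) :
    ((charIdeal (PowerSeries (IwasawaAlgebra p)) X).map (IwasawaAlgebra₂.toUnr₂ p J)).map
        (PowerSeries.constantCoeff (R := PowerSeries (PadicComplexInt p))) = ⊥ := by
  have hle : charIdeal (PowerSeries (IwasawaAlgebra p)) X ≤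
      Ideal.span {(PowerSeries.X : PowerSeries (IwasawaAlgebra p))} :=
    charIdeal_le_of_lengthAt_ne_zero
      (𝔭 := ⟨Ideal.span {(PowerSeries.X : PowerSeries (IwasawaAlgebra p))}, PowerSeries.span_X_isPrime⟩)
      htors (height_span_X (A := IwasawaAlgebra p)) h0
  refine le_bot_iff.mp ?_
  calc ((charIdeal (PowerSeries (IwasawaAlgebra p)) X).map (IwasawaAlgebra₂.toUnr₂ p J)).map
          (PowerSeries.constantCoeff (R := PowerSeries (PadicComplexInt p)))
        ≤ ((Ideal.span {(PowerSeries.X : PowerSeries (IwasawaAlgebra p))}).map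
            (IwasawaAlgebra₂.toUnr₂ p J)).map
            (PowerSeries.constantCoeff (R := PowerSeries (PadicComplexInt p))) :=
          Ideal.map_mono (Ideal.map_mono hle)
    _ = ⊥ := by
          have hX : IwasawaAlgebra₂.toUnr₂ p J PowerSeries.X = PowerSeries.X := by
            show PowerSeries.map (PowerSeries.map J) PowerSeries.X = PowerSeries.X
            exact PowerSeries.map_X _
          rw [Ideal.map_span, Set.image_singleton, hX, Ideal.map_span, Set.image_singleton,
            PowerSeries.constantCoeff_X, Ideal.span_singleton_eq_bot]

/-- **Stub S2 from "f.g. + torsion"** (dichotomy on `(T₁) ∈ Supp X`): for a finitely generated TORSION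
`Λ₂`-module `X` with `X[T₁] = 0` and a surjective `Λ₁`-linear control map `X/T₁X ↠ Y` (constants
structure), `π(ch_{Λ₂} X · Λ^ur) ⊆ ch_{Λ₁}(Y) · 𝒪⟦T⟧` for every structure map `J`. If `(T₁) ∉ Supp X`
a killing element with nonzero constant term exists (`exists_notMem_forall_smul_eq_zero_of_lengthAt_eq_zero`)
and `map_toUnr₂_map_constantCoeff_le` applies; otherwise the left side is `0`. [folklore] -/
theorem map_toUnr₂_map_constantCoeff_le_of_isTorsion (p : ℕ) [Fact p.Prime] (X : Type*)
    [AddCommGroup X] [Module (PowerSeries (IwasawaAlgebra p)) X]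
    [Module.Finite (PowerSeries (IwasawaAlgebra p)) X]
    (Y : Type*) [AddCommGroup Y] [Module (IwasawaAlgebra p) Y]
    (htors : Module.IsTorsion (PowerSeries (IwasawaAlgebra p)) X)
    (hX : ∀ x : X, (PowerSeries.X : PowerSeries (IwasawaAlgebra p)) • x = 0 → x = 0)
    (f : letI : Module (IwasawaAlgebra p)
              (QuotSMulTop (PowerSeries.X : PowerSeries (IwasawaAlgebra p)) X) :=
            Module.compHom _ (PowerSeries.C (R := IwasawaAlgebra p))
      QuotSMulTop (PowerSeries.X : PowerSeries (IwasawaAlgebra p)) X →ₗ[IwasawaAlgebra p] Y)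
    (hf : Surjective f) (J : ℤ_[p] →+* PadicComplexInt p) :
    ((charIdeal (PowerSeries (IwasawaAlgebra p)) X).map (IwasawaAlgebra₂.toUnr₂ p J)).map
        (PowerSeries.constantCoeff (R := PowerSeries (PadicComplexInt p))) ≤
      (charIdeal (IwasawaAlgebra p) Y).map (PowerSeries.map J) := by
  by_cases h0 : lengthAt (PowerSeries (IwasawaAlgebra p)) X
      ⟨Ideal.span {(PowerSeries.X : PowerSeries (IwasawaAlgebra p))}, PowerSeries.span_X_isPrime⟩ = 0
  · obtain ⟨s, hsX, hs⟩ := exists_notMem_forall_smul_eq_zero_of_lengthAt_eq_zero h0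
    exact map_toUnr₂_map_constantCoeff_le p X Y
      ⟨s, fun h => hsX ((mem_span_X_iff (A := IwasawaAlgebra p)).mpr h), hs⟩ hX f hf J
  · rw [map_toUnr₂_map_constantCoeff_eq_bot_of_lengthAt_ne_zero p X htors h0 J]
    exact bot_le

/-- **Stub S2 of line `bdpline` for the constructed carriers from "`X_Gr₂` f.g. torsion"** +
`X_Gr₂[T₁] = 0` + control (cf. `xGr₂_specialization_le_of_control`). [folklore] -/
theorem xGr₂_specialization_le_of_isTorsion {K : Type} [Field K] [NumberField K]
    (W : WeierstrassCurve K) (p : ℕ) [Fact p.Prime] (κ₁ κ₂ : ZpExtension K p)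
    (vbar : IsDedekindDomain.HeightOneSpectrum (NumberField.RingOfIntegers K))
    (γ₁ γ₂ : Field.absoluteGaloisGroup K) [Fact (ZpExtension.IsTopGeneratorPair κ₁ κ₂ γ₁ γ₂)]
    [Fact (κ₂.IsTopGenerator γ₂)]
    [Module.Finite (IwasawaAlgebra₂ p) (W.XGr₂ p κ₁ κ₂ vbar γ₁ γ₂)]
    (htors : Module.IsTorsion (IwasawaAlgebra₂ p) (W.XGr₂ p κ₁ κ₂ vbar γ₁ γ₂))
    (hX : ∀ x : W.XGr₂ p κ₁ κ₂ vbar γ₁ γ₂, (PowerSeries.X : IwasawaAlgebra₂ p) • x = 0 → x = 0)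
    (f : letI : Module (IwasawaAlgebra p)
              (QuotSMulTop (PowerSeries.X : IwasawaAlgebra₂ p) (W.XGr₂ p κ₁ κ₂ vbar γ₁ γ₂)) :=
            Module.compHom _ (PowerSeries.C (R := IwasawaAlgebra p))
      QuotSMulTop (PowerSeries.X : IwasawaAlgebra₂ p) (W.XGr₂ p κ₁ κ₂ vbar γ₁ γ₂) →ₗ[IwasawaAlgebra p]
        Castella2018.AcSelmer.XAc W p κ₂ vbar ∅ γ₂)
    (hf : Surjective f) (J : ℤ_[p] →+* PadicComplexInt p) :
    ((WeierstrassCurve.XGr₂.charIdeal W p κ₁ κ₂ vbar γ₁ γ₂).map (IwasawaAlgebra₂.toUnr₂ p J)).map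
        (PowerSeries.constantCoeff (R := PowerSeries (PadicComplexInt p))) ≤
      (Castella2018.AcSelmer.XAc.charIdeal W p κ₂ vbar ∅ γ₂).map (PowerSeries.map J) :=
  map_toUnr₂_map_constantCoeff_le_of_isTorsion p (W.XGr₂ p κ₁ κ₂ vbar γ₁ γ₂)
    (Castella2018.AcSelmer.XAc W p κ₂ vbar ∅ γ₂) htors hX f hf J

end S2

end Summit.BirchSwinnertonDyer.BirchSwinnertonDyer.Theorems.SignedBaseChangeAcDivSpecialization

end
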